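import Summits.KontsevichZagierPeriods.KontsevichZagierPeriods.Theses.HurwitzMicroSectors

/-!
# `ReductionTwoSix` (stmt-KontsevichZagierPeriods-3871) — negative side I: the bookkeeping is exact

Refuter (`cdisprove`) by-product, kernel-checked: the reduction of the level-6 weight-2 box sector to
the normal form `a + b/(1−xy) + c/(1+xy+x²y²)` is EXACT LINEAR ALGEBRA over the ℤ-linear group of
moves, with the rational scalars carried inside integrands. In ANY abelian group `V`, if
`φ r : ℚ →+ V` (think: `q ↦` class of `[q·t^r/(1−t⁶)]` on the open box, additive in `q` by integrand
additivity) satisfies the four dilation relations `Dil₂ (r = 0,1,2)`: `φ (2r+1) (4q) = φ r q + φ (r+3) q`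
and `Dil₃ (r = 1)`: `φ 5 (9q) = φ 1 q + φ 3 q + φ 5 q` (each ONE change of variables `x ↦ x^m`,
item DilationMove), then `Σ_r φ r (p r)` is the class of `b/(1−t) + c/(1+t+t²)`
(`1/(1−t) = Σ_{r<6} t^r/(1−t⁶)`, `1/(1+t+t²) = (1−t+t³−t⁴)/(1−t⁶)`) with `b = (β+4α)/36`,
`c = −α/8`, `α = p₃−p₁+5p₄−5p₀`, `β = p₅+3p₂+8p₁−8p₄+32p₀` (`bookkeeping`, explicit multipliers in its
docstring); the fifth relation `Dil₃ (r = 0)` is a consequence of the other four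
(`dil3_0_redundant`: the dilation span has rank exactly 4 = 6 − dim_ℚ⟨h₀,…,h₅⟩).
No division in `V` is used anywhere, which settles the route's "no division rule" worry.
[Milnor 1983 (Kubert identities); Lang 1990, Cyclotomic Fields II Ch. 2; Kontsevich–Zagier 2001 §1.2]
-/

namespace Summit.KontsevichZagierPeriods.HurwitzMicroSectors.ReductionTwoSixNegative

section Bookkeeping

variable {V : Type*} [AddCommGroup V]

/-- `α(p) = p₃ − p₁ + 5p₄ − 5p₀`: the `H₃`-coordinate of `Σ p_r H_r` modulo the dilation span. -/
def alpha (p : Fin 6 → ℚ) : ℚ := p 3 - p 1 + 5 * p 4 - 5 * p 0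

/-- `β(p) = p₅ + 3p₂ + 8p₁ − 8p₄ + 32p₀`: the `H₅`-coordinate of `Σ p_r H_r` modulo the dilation span. -/
def beta (p : Fin 6 → ℚ) : ℚ := p 5 + 3 * p 2 + 8 * p 1 - 8 * p 4 + 32 * p 0

/-- normal-form coefficient of `1/(1+t+t²)`: `c = −α/8`. -/
def cCoeff (p : Fin 6 → ℚ) : ℚ := - alpha p / 8

/-- normal-form coefficient of `1/(1−t)`: `b = (β+4α)/36`. -/
def bCoeff (p : Fin 6 → ℚ) : ℚ := (beta p + 4 * alpha p) / 36

/-- BOOKKEEPING THEOREM (abstract skeleton of the reduction, ℤ-linear ambient group, ℚ-scalars only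
inside the arguments): if `φ r q` stands for the class of the box integral `[q·t^r/(1−t⁶)]`
(`t = xy`) in ANY abelian group, additive in `q` (integrand additivity), and the four dilation
relations `Dil₂ (r = 0,1,2)` and `Dil₃ (r = 1)` hold for every rational scalar, then
`Σ_r φ r (p r)` equals the class of the normal form `b/(1−t) + c/(1+t+t²)`
(`1/(1−t) = Σ_r t^r/(1−t⁶)`, `1/(1+t+t²) = (1 − t + t³ − t⁴)/(1−t⁶)`) with `b = bCoeff p`,
`c = cCoeff p`. No division in the group is used: the multipliers of the four relations are the
rationals `μ₁ = p₀ − (b+c)`, `μ₂ = p₄ − (b−c)`, `μ₃ = p₂ − b`, `μ₅ = p₁ + 4p₀ − p₄ − 4b − 4c`. -/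
theorem bookkeeping (φ : Fin 6 → ℚ →+ V)
    (dil2_0 : ∀ q : ℚ, φ 1 (4 * q) = φ 0 q + φ 3 q)
    (dil2_1 : ∀ q : ℚ, φ 3 (4 * q) = φ 1 q + φ 4 q)
    (dil2_2 : ∀ q : ℚ, φ 5 (4 * q) = φ 2 q + φ 5 q)
    (dil3_1 : ∀ q : ℚ, φ 5 (9 * q) = φ 1 q + φ 3 q + φ 5 q)
    (p : Fin 6 → ℚ) :
    ∑ r, φ r (p r) =
      ∑ r, φ r (bCoeff p) +
        (φ 0 (cCoeff p) - φ 1 (cCoeff p) + φ 3 (cCoeff p) - φ 4 (cCoeff p)) := by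
  -- the four relations as annihilators
  have kill1 : ∀ μ : ℚ, φ 0 μ - φ 1 (4 * μ) + φ 3 μ = 0 := fun μ => by
    rw [dil2_0]; abel
  have kill2 : ∀ μ : ℚ, φ 1 μ - φ 3 (4 * μ) + φ 4 μ = 0 := fun μ => by
    rw [dil2_1]; abel
  have kill3 : ∀ μ : ℚ, φ 2 μ - φ 5 (3 * μ) = 0 := fun μ => by
    have e : φ 5 (3 * μ) = φ 5 (4 * μ) - φ 5 μ := by
      rw [← map_sub]; congr 1; ring
    rw [e, dil2_2]; abel
  have kill5 : ∀ μ : ℚ, φ 1 μ + φ 3 μ - φ 5 (8 * μ) = 0 := fun μ => by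
    have e : φ 5 (8 * μ) = φ 5 (9 * μ) - φ 5 μ := by
      rw [← map_sub]; congr 1; ring
    rw [e, dil3_1]; abel
  obtain ⟨b, hb⟩ : ∃ b, bCoeff p = b := ⟨_, rfl⟩
  obtain ⟨c, hc⟩ : ∃ c, cCoeff p = c := ⟨_, rfl⟩
  rw [hb, hc]
  obtain ⟨μ1, h1⟩ : ∃ μ : ℚ, μ = p 0 - (b + c) := ⟨_, rfl⟩
  obtain ⟨μ2, h2⟩ : ∃ μ : ℚ, μ = p 4 - (b - c) := ⟨_, rfl⟩
  obtain ⟨μ3, h3⟩ : ∃ μ : ℚ, μ = p 2 - b := ⟨_, rfl⟩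
  obtain ⟨μ5, h5⟩ : ∃ μ : ℚ, μ = p 1 + 4 * p 0 - p 4 - 4 * b - 4 * c := ⟨_, rfl⟩
  have e0 : p 0 = b + c + μ1 := by rw [h1]; ring
  have e4 : p 4 = b - c + μ2 := by rw [h2]; ring
  have e2 : p 2 = b + μ3 := by rw [h3]; ring
  have e1 : p 1 = b - c + (μ2 + μ5 - 4 * μ1) := by rw [h2, h5, h1]; ring
  have e3 : p 3 = b + c + (μ1 + μ5 - 4 * μ2) := by
    rw [h1, h5, h2, ← hc, ← hb]
    simp only [cCoeff, bCoeff, alpha, beta]; ring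
  have e5 : p 5 = b + (-(3 * μ3) - 8 * μ5) := by
    rw [h3, h5, ← hc, ← hb]
    simp only [cCoeff, bCoeff, alpha, beta]; ring
  simp only [Fin.sum_univ_six]
  rw [e0, e1, e2, e3, e4, e5]
  simp only [map_add, map_sub, map_neg]
  have aux : ∀ X Y K : V, K = 0 → X = Y + K → X = Y := by
    intro X Y K hK h; rw [h, hK, add_zero]
  refine aux _ _ _ (show (φ 0 μ1 - φ 1 (4 * μ1) + φ 3 μ1) + (φ 1 μ2 - φ 3 (4 * μ2) + φ 4 μ2) +
      (φ 2 μ3 - φ 5 (3 * μ3)) + (φ 1 μ5 + φ 3 μ5 - φ 5 (8 * μ5)) = 0 by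
    rw [kill1, kill2, kill3, kill5]; abel) ?_
  abel

/-- Consistency (rank) check: the fifth dilation relation `Dil₃ (r = 0)`,
`9H₂ ∼ H₀ + H₂ + H₄`, FOLLOWS from the other four — exactly 4 of the 5 are independent. -/
theorem dil3_0_redundant (φ : Fin 6 → ℚ →+ V)
    (dil2_0 : ∀ q : ℚ, φ 1 (4 * q) = φ 0 q + φ 3 q)
    (dil2_1 : ∀ q : ℚ, φ 3 (4 * q) = φ 1 q + φ 4 q)
    (dil2_2 : ∀ q : ℚ, φ 5 (4 * q) = φ 2 q + φ 5 q)
    (dil3_1 : ∀ q : ℚ, φ 5 (9 * q) = φ 1 q + φ 3 q + φ 5 q) (q : ℚ) :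
    φ 2 (9 * q) = φ 0 q + φ 2 q + φ 4 q := by
  have h2 : ∀ μ : ℚ, φ 2 μ = φ 5 (3 * μ) := fun μ => by
    have e : φ 5 (3 * μ) = φ 5 (4 * μ) - φ 5 μ := by
      rw [← map_sub]; congr 1; ring
    rw [e, dil2_2]; abel
  have h1 : ∀ μ : ℚ, φ 1 μ = φ 5 (8 * μ) - φ 3 μ := fun μ => by
    have e : φ 5 (8 * μ) = φ 5 (9 * μ) - φ 5 μ := by
      rw [← map_sub]; congr 1; ring
    rw [e, dil3_1]; abel
  have h4 : ∀ μ : ℚ, φ 4 μ = φ 3 (5 * μ) - φ 5 (8 * μ) := fun μ => by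
    have e : φ 3 (5 * μ) = φ 3 (4 * μ) + φ 3 μ := by
      rw [← map_add]; congr 1; ring
    rw [e, dil2_1, h1]; abel
  have h0 : ∀ μ : ℚ, φ 0 μ = φ 5 (32 * μ) - φ 3 (5 * μ) := fun μ => by
    have key := dil2_0 μ
    rw [h1] at key
    have e3 : φ 3 (5 * μ) = φ 3 (4 * μ) + φ 3 μ := by
      rw [← map_add]; congr 1; ring
    have e5 : φ 5 (32 * μ) = φ 5 (8 * (4 * μ)) := by congr 1; ring
    rw [e3, e5]
    calc φ 0 μ = (φ 0 μ + φ 3 μ) - φ 3 μ := by abel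
      _ = (φ 5 (8 * (4 * μ)) - φ 3 (4 * μ)) - φ 3 μ := by rw [key]
      _ = _ := by abel
  rw [h2 (9 * q), h2 q, h0 q, h4 q]
  have e : φ 5 (3 * (9 * q)) = φ 5 (32 * q) + φ 5 (3 * q) - φ 5 (8 * q) := by
    rw [← map_add, ← map_sub]; congr 1; ring
  rw [e]; abel

end Bookkeeping

end Summit.KontsevichZagierPeriods.HurwitzMicroSectors.ReductionTwoSixNegative
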